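import Mathlib
import HarnessLib
import Summits.KontsevichZagierPeriods.KontsevichZagierPeriods.Theorems.SoloInformedKubertWitness

/-!
# SoloInformed — the da Silva class at level 66: a FACTORWISE derivation of
`Γ(7/33)Γ(10/33)Γ(13/33)/(Γ(5/33)Γ(11/33)Γ(14/33)) ∈ ℚ̄` from three ℚ̄-LINEAR relations between
Beta values of level `66` (kernel certificates; the arithmetic skeleton of COROLLARY (c6))

Continuation of `SoloInformedKubertWitness`. There, the exponent vector
`f₃₃ = [7/33]+[10/33]+[13/33]-[5/33]-[11/33]-[14/33]` was shown to lie outside the standard lattice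
`L₃₃` (its Kubert class `k₃₃` is non-zero) while `2 f₃₃ ∈ L₃₃`. As an instance of Conjecture 1 of
Kontsevich–Zagier the identity reads `u = α₃₃ · v'` with `u = B(7/33,10/33,13/33)`,
`v' = B(5/33,11/33,14/33)` two Dirichlet integrals over the `2`-simplex (3-dimensional volumes, `Rung₃`),
`α₃₃ = 3^{-1/4} 11^{1/12} (Π sin)^{1/2} = 0.8353469496038…`.

Here we certify that after INFLATION to level `66` (`[a/33] = [2a/66]`) the vector decomposes as
`f = ℓ₁ + ℓ₂ + ℓ₃`, where each `ℓᵢ` is the exponent vector of a ℚ̄-linear relation between TWO Beta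
values of level `66` (periods of the Fermat curve of degree `66`):

* `ℓ₁`: `B(14/66,26/66) = β₁ · B(7/66,13/66)`, `β₁ = 0.4671440758010…` — STANDARD (`ℓ₁ ∈ L₆₆`,
  22-term certificate; a consequence of Gauss' multiplication formulas of index `2, 3, 6` and reflection);
* `ℓ₂`: `B(7/66,40/66) = β₂ · B(19/66,28/66)`, `β₂ = 2.0227738499545…` — STANDARD (`ℓ₂ ∈ L₆₆`, 23 terms);
* `ℓ₃`: `B(13/66,19/66) = β₃ · B(5/33,11/33)`,
  `β₃ = 2^{166/33} 3^{-1/4} 11^{1/12} (Π sin)^{1/2} = 0.8840334841937…` — NOT standard: `ℓ₃ ∉ L₆₆`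
  (parity functional `x ↦ x(1/3)+x(2/3)`) while `2ℓ₃ ∈ L₆₆` (25-term certificate). `ℓ₃` has LENGTH 4:
  reflection-normalised it is the zero-sum Hodge quadruple `(13,19,44,56)` of the Fermat SURFACE `X²₆₆`
  (`soloInformed_quad66_hodge`: `⟨13t⟩+⟨19t⟩+⟨44t⟩+⟨56t⟩ = 2·66` for every unit `t`), a `(1,1)`-class,
  algebraic by Lefschetz; the linear relation `ℓ₃` is therefore decided by the Huber–Wüstholz theorem.

So `β₁ β₂ β₃ = α₃₃`, and the class `k₃₃`, of minimal length `6` at level `33` (a `(2,2)`-class on the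
fourfold `X⁴₃₃`), has length `4` at level `66`. READING FOR THE SUMMIT (paper/main.md §7 (c6)): with the
three Dirichlet refactorisations `B(a,b)B(a+b,c) = B(b,c)B(b+c,a)` (explicit substitution chains), the
`Rung₃` instance `[u] ∼ α₃₃ [v']` of Conjecture 1 is a composite of three `Rung₂` instances, hence holds in
the formal period ring granted Huber–Wüstholz alone (`soloInformed_volumeRung_le_two`) — no Hodge-conjecture
input, no cancellation. This is the period-side shadow of Jumagulov's Theorem 1.4 (arXiv:2608.18134: the
class lifts to level `66`, where it is quasi-decomposable). The search that found the path and the closed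
forms: `work/s69/beta_path_k.py`, `closed_forms.py` (solo-informed HOME). By contrast the Kubert class `k₃₅`
admits no such factorwise derivation at any level `35t ≤ 420` (ibid.). Everything below is `decide`.
-/

namespace Summit.KontsevichZagierPeriods.KontsevichZagierPeriods.Theorems

/-! ## Beta exponent vectors and the three level-66 relations -/

/-- Exponent vector of the Beta symbol `B(a/N,b/N) = Γ(a/N)Γ(b/N)/Γ((a+b)/N)`: `e_a + e_b - e_{a+b}`,
with the convention `e_0 := 0` (a `Γ`-value at an integer is rational). -/
def soloInformedBetaVec (N : ℕ) (a b : ZMod N) : ZMod N → ℤ :=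
  fun x => (if a = x then 1 else 0) + (if b = x then 1 else 0) - (if a + b = x ∧ x ≠ 0 then 1 else 0)

/-- da Silva's exponent vector inflated to level `66`: `[14/66]+[20/66]+[26/66]-[10/66]-[22/66]-[28/66]`. -/
def soloInformedDaSilva66 : ZMod 66 → ℤ :=
  fun x => (if x = 14 ∨ x = 20 ∨ x = 26 then 1 else 0) - (if x = 10 ∨ x = 22 ∨ x = 28 then 1 else 0)

/-- `soloInformedDaSilva66` is the inflation of `soloInformedDaSilva33`: it agrees with it on even
residues `2a` and vanishes on odd residues. -/
theorem soloInformed_daSilva66_infl :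
    (∀ a : ZMod 33, soloInformedDaSilva66 ((2 * a.val : ℕ) : ZMod 66) = soloInformedDaSilva33 a) ∧
    (∀ x : ZMod 66, x.val % 2 = 1 → soloInformedDaSilva66 x = 0) := by
  constructor
  · intro a; revert a; decide
  · intro x; revert x; decide

/-- The inflated vector is `vec(u) - vec(v')` for the Dirichlet factorisations
`u = B(14,20)·B(34,26)` and `v' = B(10,22)·B(32,28)` (numerators over `66`). -/
theorem soloInformed_daSilva66_eq_beta :
    soloInformedDaSilva66 =
      (soloInformedBetaVec 66 14 20 + soloInformedBetaVec 66 34 26) -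
        (soloInformedBetaVec 66 10 22 + soloInformedBetaVec 66 32 28) := by
  funext x; revert x; decide

/-- `ℓ₁ = vec B(14/66,26/66) - vec B(7/66,13/66)`. -/
def soloInformedRel66a : ZMod 66 → ℤ := soloInformedBetaVec 66 14 26 - soloInformedBetaVec 66 7 13

/-- `ℓ₂ = vec B(7/66,40/66) - vec B(19/66,28/66)`. -/
def soloInformedRel66b : ZMod 66 → ℤ := soloInformedBetaVec 66 7 40 - soloInformedBetaVec 66 19 28

/-- `ℓ₃ = vec B(13/66,19/66) - vec B(10/66,22/66)` (the non-standard, length-4 relation). -/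
def soloInformedRel66c : ZMod 66 → ℤ := soloInformedBetaVec 66 13 19 - soloInformedBetaVec 66 10 22

/-- **The factorwise decomposition**: `f = ℓ₁ + ℓ₂ + ℓ₃` at level `66`. -/
theorem soloInformed_daSilva66_eq_sum :
    soloInformedDaSilva66 = soloInformedRel66a + soloInformedRel66b + soloInformedRel66c := by
  funext x; revert x; decide

/-- The path itself, step by step (Dirichlet refactorisations are identities of Beta vectors):
`u = B(14,20)B(34,26) = B(14,26)B(40,20)` →ℓ₁ `B(7,13)B(40,20) = B(7,40)B(47,13)` →ℓ₂
`B(19,28)B(47,13) = B(13,19)B(32,28)` →ℓ₃ `B(10,22)B(32,28) = v'`. -/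
theorem soloInformed_daSilva66_path :
    soloInformedBetaVec 66 14 20 + soloInformedBetaVec 66 34 26 =
      soloInformedBetaVec 66 14 26 + soloInformedBetaVec 66 40 20 ∧
    soloInformedBetaVec 66 14 26 + soloInformedBetaVec 66 40 20 - soloInformedRel66a =
      soloInformedBetaVec 66 7 40 + soloInformedBetaVec 66 47 13 ∧
    soloInformedBetaVec 66 7 40 + soloInformedBetaVec 66 47 13 - soloInformedRel66b =
      soloInformedBetaVec 66 13 19 + soloInformedBetaVec 66 32 28 ∧
    soloInformedBetaVec 66 13 19 + soloInformedBetaVec 66 32 28 - soloInformedRel66c =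
      soloInformedBetaVec 66 10 22 + soloInformedBetaVec 66 32 28 := by
  refine ⟨?_, ?_, ?_, ?_⟩ <;> (funext x; revert x; decide)

/-! ## `ℓ₁, ℓ₂` are standard -/

/-- Integer certificate for `ℓ₁` (22 signed generators of `L₆₆`). -/
def soloInformedRel66aCert : List (ℤ × (ZMod 66 ⊕ (ℕ × ZMod 66))) :=
  [ (-1, .inr (11, 2)), (-1, .inr (11, 3)), (1, .inr (11, 4)), (-1, .inr (11, 5)),
    (1, .inr (22, 3)), (1, .inr (22, 4)), (1, .inr (22, 5)), (-1, .inr (22, 6)), (-2, .inr (22, 8)),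
    (1, .inr (33, 2)), (-1, .inr (33, 4)),
    (1, .inl 6), (-1, .inl 7), (1, .inl 8), (1, .inl 9), (2, .inl 14), (1, .inl 16), (-2, .inl 18),
    (1, .inl 20), (-1, .inl 26), (1, .inl 28), (1, .inl 30) ]

/-- `ℓ₁ ∈ L₆₆`: the relation `B(14/66,26/66) = β₁ B(7/66,13/66)` is a consequence of the functional
equations of `Γ`. -/
theorem soloInformed_rel66a_mem : soloInformedRel66a ∈ soloInformedStdLattice 66 := by
  have h : soloInformedRel66a = soloInformedCombo 66 soloInformedRel66aCert := by
    funext x; revert x; decide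
  rw [h]
  exact soloInformed_combo_mem 66 _ (by decide)

/-- Integer certificate for `ℓ₂` (23 signed generators of `L₆₆`). -/
def soloInformedRel66bCert : List (ℤ × (ZMod 66 ⊕ (ℕ × ZMod 66))) :=
  [ (-1, .inr (11, 1)), (1, .inr (11, 3)), (-1, .inr (11, 4)), (1, .inr (11, 5)),
    (1, .inr (22, 1)), (-1, .inr (22, 5)), (1, .inr (22, 8)), (-1, .inr (22, 10)),
    (1, .inr (33, 4)), (1, .inr (33, 8)),
    (-1, .inl 6), (1, .inl 7), (-1, .inl 8), (1, .inl 10), (1, .inl 12), (-1, .inl 14), (1, .inl 18),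
    (-1, .inl 19), (-1, .inl 25), (1, .inl 26), (-1, .inl 28), (-1, .inl 30), (1, .inl 32) ]

/-- `ℓ₂ ∈ L₆₆`: the relation `B(7/66,40/66) = β₂ B(19/66,28/66)` is a consequence of the functional
equations of `Γ`. -/
theorem soloInformed_rel66b_mem : soloInformedRel66b ∈ soloInformedStdLattice 66 := by
  have h : soloInformedRel66b = soloInformedCombo 66 soloInformedRel66bCert := by
    funext x; revert x; decide
  rw [h]
  exact soloInformed_combo_mem 66 _ (by decide)

/-! ## `ℓ₃` is a non-zero Kubert class of length 4 -/

/-- The parity functional `x ↦ x(1/3) + x(2/3)` at level `66`. -/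
def soloInformedParity66 : (ZMod 66 → ℤ) →ₗ[ℤ] ℤ where
  toFun v := v 22 + v 44
  map_add' u w := by simp only [Pi.add_apply]; ring
  map_smul' c u := by simp only [Pi.smul_apply, smul_eq_mul, RingHom.id_apply]; ring

/-- Pointwise formula for the level-66 parity functional. -/
theorem soloInformedParity66_apply (v : ZMod 66 → ℤ) : soloInformedParity66 v = v 22 + v 44 := rfl

/-- The level-66 parity functional is even on every standard generator. -/
theorem soloInformedParity66_gen : ∀ v ∈ soloInformedStdGen 66, soloInformedParity66 v % 2 = 0 := by
  rintro v (⟨a, rfl⟩ | ⟨M, hM, y, rfl⟩) <;> rw [soloInformedParity66_apply]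
  · revert a; decide
  · revert y; revert hM; revert M; decide

/-- **`ℓ₃` is not standard**: `B(13/66,19/66)/B(5/33,11/33) ∈ ℚ̄` is not a consequence of reflection
and multiplication. -/
theorem soloInformed_rel66c_not_mem : soloInformedRel66c ∉ soloInformedStdLattice 66 := by
  intro h
  have h2 := soloInformed_stdLattice_parity 66 soloInformedParity66 soloInformedParity66_gen _ h
  rw [soloInformedParity66_apply] at h2
  revert h2; decide

/-- Integer certificate for `2ℓ₃` (25 signed generators of `L₆₆`). -/
def soloInformedRel66cCert : List (ℤ × (ZMod 66 ⊕ (ℕ × ZMod 66))) :=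
  [ (1, .inr (6, 2)), (2, .inr (11, 1)), (2, .inr (11, 2)), (-2, .inr (22, 1)), (-1, .inr (22, 2)),
    (-2, .inr (22, 3)), (-1, .inr (22, 4)), (1, .inr (22, 6)), (1, .inr (22, 8)), (1, .inr (22, 10)),
    (-2, .inr (33, 2)), (-2, .inr (33, 8)),
    (-1, .inl 4), (-2, .inl 9), (-3, .inl 10), (-1, .inl 12), (-1, .inl 14), (-2, .inl 16), (1, .inl 18),
    (2, .inl 19), (-1, .inl 20), (-1, .inl 22), (2, .inl 25), (-1, .inl 28), (-2, .inl 32) ]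

/-- … while `2ℓ₃ ∈ L₆₆` (so `β₃² ∈ ℚ̄` by the functional equations and `β₃` is algebraic). -/
theorem soloInformed_two_rel66c_mem : (2 : ℤ) • soloInformedRel66c ∈ soloInformedStdLattice 66 := by
  have h : (2 : ℤ) • soloInformedRel66c = soloInformedCombo 66 soloInformedRel66cCert := by
    funext x
    simp only [Pi.smul_apply, smul_eq_mul]
    revert x; decide
  rw [h]
  exact soloInformed_combo_mem 66 _ (by decide)

/-- `ℓ₃` has length `4`: it is `e₁₃ + e₁₉ - e₁₀ - e₂₂`. -/
theorem soloInformed_rel66c_eq :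
    soloInformedRel66c = fun x => (if x = 13 ∨ x = 19 then 1 else 0) - (if x = 10 ∨ x = 22 then 1 else 0) := by
  funext x; revert x; decide

/-- The reflection-normalised form of `ℓ₃`, the quadruple `(13,19,44,56)` of level `66`, is a zero-sum
HODGE character of the Fermat surface `X²₆₆`: for every unit `t` of `ℤ/66`,
`⟨13t⟩ + ⟨19t⟩ + ⟨44t⟩ + ⟨56t⟩ = 2·66` (Koblitz–Ogus / Shioda condition; a `(1,1)`-class, algebraic by
Lefschetz). -/
theorem soloInformed_quad66_hodge :
    (13 + 19 + 44 + 56 : ℕ) = 2 * 66 ∧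
    ∀ t : ZMod 66, Nat.Coprime t.val 66 →
      (t * 13).val + (t * 19).val + (t * 44).val + (t * 56).val = 2 * 66 := by
  constructor
  · decide
  · intro t; revert t; decide

/-! ## Consequences at level 66 -/

/-- The inflated da Silva vector is still not standard at level `66` … -/
theorem soloInformed_daSilva66_not_mem : soloInformedDaSilva66 ∉ soloInformedStdLattice 66 := by
  intro h
  have h2 := soloInformed_stdLattice_parity 66 soloInformedParity66 soloInformedParity66_gen _ h
  rw [soloInformedParity66_apply] at h2
  revert h2; decide

/-- … but it is standard MODULO the single length-4 relation `ℓ₃`: `f - ℓ₃ = ℓ₁ + ℓ₂ ∈ L₆₆`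
(the class `k₃₃` has length `4` at level `66`). -/
theorem soloInformed_daSilva66_sub_rel66c_mem :
    soloInformedDaSilva66 - soloInformedRel66c ∈ soloInformedStdLattice 66 := by
  have h : soloInformedDaSilva66 - soloInformedRel66c = soloInformedRel66a + soloInformedRel66b := by
    rw [soloInformed_daSilva66_eq_sum]; abel
  rw [h]
  exact Submodule.add_mem _ soloInformed_rel66a_mem soloInformed_rel66b_mem

/-- Summary (the arithmetic skeleton of COROLLARY (c6)): at level `66` the da Silva vector is the sum of
two standard relation vectors and one non-standard Kubert `2`-torsion vector of length `4` whose
normalised quadruple is a Hodge class of the Fermat surface of degree `66`. -/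
theorem soloInformed_daSilva66_factorwise :
    soloInformedDaSilva66 = soloInformedRel66a + soloInformedRel66b + soloInformedRel66c ∧
    soloInformedRel66a ∈ soloInformedStdLattice 66 ∧ soloInformedRel66b ∈ soloInformedStdLattice 66 ∧
    (soloInformedRel66c ∉ soloInformedStdLattice 66 ∧
      (2 : ℤ) • soloInformedRel66c ∈ soloInformedStdLattice 66) ∧
    (∀ t : ZMod 66, Nat.Coprime t.val 66 →
      (t * 13).val + (t * 19).val + (t * 44).val + (t * 56).val = 2 * 66) :=
  ⟨soloInformed_daSilva66_eq_sum, soloInformed_rel66a_mem, soloInformed_rel66b_mem,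
   ⟨soloInformed_rel66c_not_mem, soloInformed_two_rel66c_mem⟩, soloInformed_quad66_hodge.2⟩

end Summit.KontsevichZagierPeriods.KontsevichZagierPeriods.Theorems
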